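import Literature.NumberTheory.LFunctions.OneLevelDensityDirichletFamily
import Literature.NumberTheory.LFunctions.RHWave0
import HarnessLib

/-!
# Simple zeros and the `q`-analogue of pair correlation for the family of ALL primitive Dirichlet
# characters, via the asymptotic large sieve (Chandee–Lee–Liu–Radziwiłł 2014, Theorem 1 and
# Proposition 1; on GRH)

Topic `Literature/NumberTheory/LFunctions` (namespace `Literature.NumberTheory.LFunctions`,
sub-namespace `CLLR2014`). STATEMENT LAYER (D-0014: sorry-free named `Prop` facts, nothing
asserted), typed for sub-cell C (literature harvest) of the cell `landau-siegel` (rung F-S3;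
HOME/lit/r1/ROWS.md row r1-P10 / r1-OQ08). The two statements fix, in print, how far a
PRIME-supported Dirichlet polynomial `Σ_n Λ(n) χ(n) Φ(n/X) n^{-1/2}` can be evaluated in mean
square over the family of all primitive characters of modulus `q ≍ Q` (weight `W(q/Q)/φ(q)`):
`X = Q^α` with `|α| ≤ 2 − ε` — the "support-`2`" edge of the asymptotic large sieve in the
pair-correlation normalisation (Proposition 1) — and the resulting proportion `≥ 11/12` of simple
zeros (Theorem 1). BOTH ARE CONDITIONAL ON GRH ("Throughout this paper GRH is assumed"), typed with
the tree's `GeneralizedRiemannHypothesis` as an explicit hypothesis. Theorems in print, typed as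
named facts; not conjectures and not claims about Landau–Siegel zeros or about arXiv:2211.02515.
Companions: `AsymptoticLargeSieve.lean` (CIS Thms 2.2/2.4, the tool), `OneLevelDensityDirichletFamily.lean`
(support `2` resp. `2 + 50/1093` for the linear statistic), `TwistedSecondMomentModuliAverage.lean`.

## What the source prints (arXiv:1211.6725 = Q. J. Math. 65 (2014) 63–87, TeX source read
## 2026-08-26, §1)

"Throughout this paper GRH is assumed. Let `Φ` be a smooth function which is real and compactly
supported in `(a,b)` with `0 < a < b`, and define its Mellin transform `Φ̂(s) = ∫_0^∞ Φ(x) x^{s-1} dx`.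
Let `N_Φ(Q) := Σ_q W(q/Q)/φ(q) Σ*_{χ (mod q)} Σ_{γ_χ} |Φ̂(iγ_χ)|²` with `W` a smooth function,
compactly supported in `(1,2)`, the second sum being over primitive characters `χ`, and the last sum
being over all non-trivial zeros `1/2 + iγ_χ` of Dirichlet `L`-function `L(s,χ)`. …

**Theorem 1.** Assume GRH. The proportion of simple zeros of all primitive Dirichlet `L`-functions
is greater than or equal to `11/12` in the sense of the inequality
`(1/N_Φ(Q)) Σ_q W(q/Q)/φ(q) Σ*_{χ (mod q)} Σ_{γ_χ simple} |Φ̂(iγ_χ)|² ≥ 11/12 + o(1)`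
with the sum being over primitive characters and with `Φ` chosen so that `Φ̂(ix) = (sin x / x)²`.
We note that the function `Φ` satisfying `Φ̂(ix) = (sin x/x)²` is not smooth, but we can still apply
Theorem 2 to `Φ` since the condition `Φ̂(ix) ≪ |x|^{-2}` is good enough in our proof and can
replace the smoothness. …

**Proposition 1.** Assume GRH. Let `ε > 0` and `X = Q^α`. Then
`Σ_q W(q/Q)/φ(q) Σ*_{χ (mod q)} |Σ_n Λ(n) χ(n) Φ(n/X) / n^{1/2}|² ∼ f(α) N_Φ(Q)`
uniformly for `|α| ≤ 2 − ε` as `Q → ∞`, where `f(α) := |α|` for `|α| ≤ 1`, `1` for `|α| > 1`."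
(§1, after Theorem 2: "Since primitive Dirichlet `L`-functions form a unitary family, we conjecture
that for `α ≥ 2` the same asymptotic formula continues to hold." — the support-`2` edge; not typed,
it is a conjecture.)

## Lean rendering / design choices

* ZEROS: the tree's `ExplicitPsiChar.charNontrivialZeros χ = {ρ : L(ρ,χ) = 0, 0 < Re ρ < 1}` with
  multiplicity `DirichletDisc.zeroOrder χ ρ` (via `CharZeroSum`); writing `ρ = 1/2 + iγ` we have
  `iγ = ρ − 1/2`, so `Φ̂(iγ_χ) = Φ̂(ρ − 1/2)`; "simple" = `zeroOrder = 1`. The zero sums are `tsum`s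
  over the zero subtype weighted by multiplicity (absolutely convergent for the `Φ` in play: `Φ̂`
  decays at least quadratically on vertical lines; for a non-summable junk case the `tsum` is `0`,
  which only weakens nothing here since both facts are typed for the printed `Φ`'s).
* `Φ̂` = Mathlib `mellin` (`∫_{Ioi 0} t^{s−1} Φ(t) dt`) of the complexified `Φ`.
* MODULI: `W` smooth with `tsupport W ⊆ [1,2]` (printed: compact support in `(1,2)`), so the `q`-sum
  is the finite sum over `q = n+1 ≤ 3⌈Q⌉` (pattern of `OneLevelDensity.primitiveFamilySum`); we ADD
  `W ≥ 0` as a hypothesis (weaker statement; it is what makes "proportion" meaningful and is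
  implicit in the source).
* PROPOSITION 1: `Φ` real smooth with `tsupport Φ ⊆ [a,b]`, `0 < a < b` given as data; the prime sum
  `Σ_n Λ(n)χ(n)Φ(n/X)n^{-1/2}` is the finite sum over `1 ≤ n ≤ ⌊bX⌋ + 1`; "`∼ f(α) N_Φ(Q)` uniformly
  for `|α| ≤ 2 − ε`" is typed in the ADDITIVE form `|S(Q,α) − f(α)N_Φ(Q)| ≤ δ·N_Φ(Q)` for all
  `Q ≥ Q₀(ε, δ, Φ, W)` and all `α ∈ [−2+ε, 2−ε]` — implied by the ratio form since `0 ≤ f ≤ 1`, and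
  meaningful also where `f(α) = 0`.
* THEOREM 1: the specific test function with `Φ̂(ix) = (sin x/x)²` is `Φ₀(y) = (1/2)·max(0, 1 − |log y|/2)`
  (supported on `[e^{−2}, e^{2}]`; `∫ Φ₀(e^u) e^{ixu} du = (sin x/x)²`), typed explicitly (`phi0`);
  "`≥ 11/12 + o(1)`" = `∀ δ > 0 ∃ Q₀ ∀ Q ≥ Q₀: simple-weighted count ≥ (11/12 − δ) N_{Φ₀}(Q)`.
* GRH = `Literature.NumberTheory.LFunctions.GeneralizedRiemannHypothesis` (`RHWave0.lean`), an
  explicit hypothesis of both facts. No instances, no notation.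
PROVED here (bookkeeping only): `CLLR2014.f_of_abs_le_one`, `f_of_one_lt_abs`, `f_le_one`,
`f_nonneg`, and `phi0_nonneg` / `phi0_eq_zero_of_two_lt_abs_log` (the support of `Φ₀`).

## References

* [ChandeeLeeLiuRadziwill2014] §1: definitions of `Φ̂`, `N_Φ(Q)`, `A`; Theorem 1; Theorem 2 and
  the conjecture for `α ≥ 2`; Proposition 1 and the explicit formula preceding it.
* [ConreyIwaniecSoundararajan2011ALS] (the tool; typed in `AsymptoticLargeSieve.lean`).
-/

noncomputable section

open Finset
open scoped ContDiff

namespace Literature.NumberTheory.LFunctions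

namespace CLLR2014

/-! ### Test functions and zero-weighted family counts -/

/-- The Mellin transform `Φ̂(s) = ∫_0^∞ Φ(x) x^{s−1} dx` of a real test function (Mathlib `mellin`).
[cite: ChandeeLeeLiuRadziwill2014, §1 (definition of Φ̂)] -/
def mellinHat (Φ : ℝ → ℝ) (s : ℂ) : ℂ :=
  mellin (fun x => ((Φ x : ℝ) : ℂ)) s

variable {q : ℕ} [NeZero q]

/-- `Σ_{γ_χ} |Φ̂(iγ_χ)|²` over the non-trivial zeros `ρ = 1/2 + iγ_χ` of `L(s,χ)` (so
`iγ_χ = ρ − 1/2`), counted with multiplicity. [cite: ChandeeLeeLiuRadziwill2014, §1 (N_Φ(Q))] -/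
def zeroWeight (χ : DirichletCharacter ℂ q) (Φ : ℝ → ℝ) : ℝ :=
  ∑' ρ : ExplicitPsiChar.charNontrivialZeros χ,
    (DirichletDisc.zeroOrder χ (ρ : ℂ) : ℝ) * ‖mellinHat Φ ((ρ : ℂ) - 1 / 2)‖ ^ 2

open scoped Classical in
/-- `Σ_{γ_χ simple} |Φ̂(iγ_χ)|²`: the same sum restricted to SIMPLE zeros (`zeroOrder = 1`).
[cite: ChandeeLeeLiuRadziwill2014, Theorem 1] -/
def simpleZeroWeight (χ : DirichletCharacter ℂ q) (Φ : ℝ → ℝ) : ℝ :=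
  ∑' ρ : ExplicitPsiChar.charNontrivialZeros χ,
    if DirichletDisc.zeroOrder χ (ρ : ℂ) = 1 then ‖mellinHat Φ ((ρ : ℂ) - 1 / 2)‖ ^ 2 else 0

open scoped Classical in
/-- The family average with the weight `W(q/Q)/φ(q)` over primitive characters:
`Σ_q W(q/Q)/φ(q) Σ*_{χ (mod q)} F(χ)`; finite `q`-range `q = n+1 ≤ 3⌈Q⌉` since `W` lives on `[1,2]`.
[cite: ChandeeLeeLiuRadziwill2014, §1 (N_Φ(Q))] -/
def familyAvg (W : ℝ → ℝ) (Q : ℝ) (F : (n : ℕ) → DirichletCharacter ℂ (n + 1) → ℝ) : ℝ :=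
  ∑ n ∈ Finset.range (3 * ⌈Q⌉₊),
    W (((n + 1 : ℕ) : ℝ) / Q) / (Nat.totient (n + 1) : ℝ) *
      ∑ χ : DirichletCharacter ℂ (n + 1) with χ.IsPrimitive, F n χ

/-- `N_Φ(Q) = Σ_q W(q/Q)/φ(q) Σ*_χ Σ_{γ_χ} |Φ̂(iγ_χ)|²`.
[cite: ChandeeLeeLiuRadziwill2014, §1 (N_Φ(Q))] -/
def NPhi (W Φ : ℝ → ℝ) (Q : ℝ) : ℝ :=
  familyAvg W Q (fun _ χ => zeroWeight χ Φ)

/-- The simple-zero version of `N_Φ(Q)` (numerator of Theorem 1).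
[cite: ChandeeLeeLiuRadziwill2014, Theorem 1] -/
def NPhiSimple (W Φ : ℝ → ℝ) (Q : ℝ) : ℝ :=
  familyAvg W Q (fun _ χ => simpleZeroWeight χ Φ)

/-! ### Proposition 1: the prime sum -/

/-- `Σ_n Λ(n) χ(n) Φ(n/X) n^{−1/2}` (finite: `Φ` is supported in `[a, b]`, so `n ≤ bX`; summed over
`1 ≤ n ≤ ⌊bX⌋ + 1`). [cite: ChandeeLeeLiuRadziwill2014, Proposition 1] -/
def primeSum (χ : DirichletCharacter ℂ q) (Φ : ℝ → ℝ) (b X : ℝ) : ℂ :=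
  ∑ n ∈ Icc 1 (⌊b * X⌋₊ + 1),
    ((ArithmeticFunction.vonMangoldt n : ℝ) : ℂ) * χ (n : ZMod q) *
      ((Φ ((n : ℝ) / X) : ℝ) : ℂ) / ((Real.sqrt n : ℝ) : ℂ)

/-- The mean square of Proposition 1:
`S(Q, α) = Σ_q W(q/Q)/φ(q) Σ*_χ |Σ_n Λ(n)χ(n)Φ(n/X)n^{−1/2}|²`, `X = Q^α`.
[cite: ChandeeLeeLiuRadziwill2014, Proposition 1] -/
def primeMeanSquare (W Φ : ℝ → ℝ) (b Q α : ℝ) : ℝ :=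
  familyAvg W Q (fun _ χ => ‖primeSum χ Φ b (Q ^ α)‖ ^ 2)

/-- The pair-correlation diagonal function `f(α) = |α|` for `|α| ≤ 1`, `1` for `|α| > 1`.
[cite: ChandeeLeeLiuRadziwill2014, Theorem 2 (eqn f alpha)] -/
def f (α : ℝ) : ℝ := min |α| 1

/-! ### Theorem 1: the Fejér-type test function -/

/-- The test function with `Φ̂₀(ix) = (sin x/x)²`: `Φ₀(y) = (1/2)·max(0, 1 − |log y|/2)` (`y > 0`),
supported on `[e^{−2}, e^{2}]`; indeed `∫_ℝ Φ₀(e^u) e^{ixu} du = ∫_{−2}^{2} (1/2)(1 − |u|/2) e^{ixu} du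
= (sin x/x)²`. (The source only specifies `Φ` through `Φ̂(ix) = (sin x/x)²`.)
[cite: ChandeeLeeLiuRadziwill2014, Theorem 1] -/
def phi0 (y : ℝ) : ℝ := (1 / 2) * max 0 (1 - |Real.log y| / 2)

/-! ### Admissibility predicates -/

/-- The modulus weight: smooth, supported in `[1,2]`, and (added, see module docstring) `≥ 0`.
[cite: ChandeeLeeLiuRadziwill2014, §1] -/
def IsWeight (W : ℝ → ℝ) : Prop :=
  ContDiff ℝ ∞ W ∧ tsupport W ⊆ Set.Icc (1 : ℝ) 2 ∧ ∀ x, 0 ≤ W x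

/-- The test functions of Proposition 1: smooth, real, supported in `[a, b]` with `0 < a < b`.
[cite: ChandeeLeeLiuRadziwill2014, §1] -/
def IsTestFn (Φ : ℝ → ℝ) (a b : ℝ) : Prop :=
  0 < a ∧ a < b ∧ ContDiff ℝ ∞ Φ ∧ tsupport Φ ⊆ Set.Icc a b

end CLLR2014

open CLLR2014

/-! ### The named facts -/

/-- **Chandee–Lee–Liu–Radziwiłł 2014, Proposition 1** (asymptotic large sieve for prime-supported
coefficients on GRH): assuming GRH, for `Φ` smooth real supported in `[a,b] ⊂ (0,∞)`, `W` smooth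
supported in `[1,2]` (and `≥ 0`), and `ε > 0`,
`Σ_q W(q/Q)/φ(q) Σ*_χ |Σ_n Λ(n)χ(n)Φ(n/X)n^{−1/2}|² ∼ f(α)·N_Φ(Q)` uniformly for `X = Q^α`,
`|α| ≤ 2 − ε`, typed additively: `∀ δ > 0 ∃ Q₀ ∀ Q ≥ Q₀ ∀ α ∈ [−2+ε, 2−ε],
|S(Q,α) − f(α)N_Φ(Q)| ≤ δ N_Φ(Q)`. NAMED FACT (theorem in print, conditional on GRH as printed), not
proved here. [cite: ChandeeLeeLiuRadziwill2014, Proposition 1] -/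
def chandeeLeeLiuRadziwill2014_proposition1 : Prop :=
  GeneralizedRiemannHypothesis →
    ∀ W : ℝ → ℝ, IsWeight W → ∀ Φ : ℝ → ℝ, ∀ a b : ℝ, IsTestFn Φ a b →
      ∀ ε : ℝ, 0 < ε → ∀ δ : ℝ, 0 < δ →
        ∃ Q₀ : ℝ, ∀ Q : ℝ, Q₀ ≤ Q → ∀ α : ℝ, |α| ≤ 2 - ε →
          |primeMeanSquare W Φ b Q α - f α * NPhi W Φ Q| ≤ δ * NPhi W Φ Q

/-- **Chandee–Lee–Liu–Radziwiłł 2014, Theorem 1** (on GRH, at least `11/12` of the zeros of all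
primitive Dirichlet `L`-functions are simple, in the weighted sense): assuming GRH, for `W` smooth
supported in `[1,2]` (and `≥ 0`) and the test function `Φ₀` with `Φ̂₀(ix) = (sin x/x)²`,
`Σ_q W(q/Q)/φ(q) Σ*_χ Σ_{γ_χ simple}|Φ̂₀(iγ_χ)|² ≥ (11/12 + o(1))·N_{Φ₀}(Q)`, typed as
`∀ δ > 0 ∃ Q₀ ∀ Q ≥ Q₀: N^{simple}_{Φ₀}(Q) ≥ (11/12 − δ) N_{Φ₀}(Q)`. NAMED FACT (conditional on GRH
as printed), not proved here. [cite: ChandeeLeeLiuRadziwill2014, Theorem 1] -/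
def chandeeLeeLiuRadziwill2014_theorem1 : Prop :=
  GeneralizedRiemannHypothesis →
    ∀ W : ℝ → ℝ, IsWeight W → ∀ δ : ℝ, 0 < δ →
      ∃ Q₀ : ℝ, ∀ Q : ℝ, Q₀ ≤ Q → (11 / 12 - δ) * NPhi W phi0 Q ≤ NPhiSimple W phi0 Q

/-! ### Bookkeeping (proved) -/

namespace CLLR2014

/-- `f(α) = |α|` on `|α| ≤ 1`. [cite: ChandeeLeeLiuRadziwill2014, (eqn f alpha)] -/
theorem f_of_abs_le_one {α : ℝ} (h : |α| ≤ 1) : f α = |α| := by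
  unfold f; exact min_eq_left h

/-- `f(α) = 1` on `|α| > 1`. [cite: ChandeeLeeLiuRadziwill2014, (eqn f alpha)] -/
theorem f_of_one_lt_abs {α : ℝ} (h : 1 < |α|) : f α = 1 := by
  unfold f; exact min_eq_right h.le

/-- `0 ≤ f(α) ≤ 1` — why the additive `o(N_Φ(Q))` reading of Proposition 1 is implied by the printed
`∼`. [cite: ChandeeLeeLiuRadziwill2014, Proposition 1] -/
theorem f_le_one (α : ℝ) : f α ≤ 1 := min_le_right _ _

/-- `0 ≤ f(α)`. [cite: ChandeeLeeLiuRadziwill2014, (eqn f alpha)] -/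
theorem f_nonneg (α : ℝ) : 0 ≤ f α := le_min (abs_nonneg α) zero_le_one

/-- `Φ₀ ≥ 0`. [cite: ChandeeLeeLiuRadziwill2014, Theorem 1] -/
theorem phi0_nonneg (y : ℝ) : 0 ≤ phi0 y := by
  unfold phi0
  exact mul_nonneg (by norm_num) (le_max_left _ _)

/-- `Φ₀(y) = 0` once `|log y| > 2`, i.e. outside `[e^{−2}, e^{2}]`.
[cite: ChandeeLeeLiuRadziwill2014, Theorem 1] -/
theorem phi0_eq_zero_of_two_lt_abs_log {y : ℝ} (h : 2 < |Real.log y|) : phi0 y = 0 := by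
  unfold phi0
  have : 1 - |Real.log y| / 2 ≤ 0 := by linarith
  rw [max_eq_left this]
  simp

/-- The value at the centre: `Φ₀(1) = 1/2` (so `Φ̂₀(0) = ∫ Φ₀(e^u) du = 1 = lim_{x→0}(sin x/x)²`).
[cite: ChandeeLeeLiuRadziwill2014, Theorem 1] -/
theorem phi0_one : phi0 1 = 1 / 2 := by
  simp [phi0]

end CLLR2014

end Literature.NumberTheory.LFunctions

end
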